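import Summits.QuantumFields.YangMills.Theorems.BalabanUVNodesN22W1RelCentredTermDatum214WindowDilatedKeyedCoP

/-!
# BalabanUVNodes ∕ node N22 = NE9 — THE W1 OBJECT ON THE RELATIVE-DISC CENTRED ROAD (RE-TYPING M1′), MODULE J4: THE EDGE N18 → N22 AT THE READING OF RECORD (CoP EDITION), ALL RUN LENGTHS,
# IN THE PRODUCER's WINDOW-DILATED MEMBER CURRENCY — `S_N22 (RRec₁₃CoP[On] (readingOfRecord₁₃CoP w1 …))` FROM `S_N18` THERE + the member statements AT EVERY LEVEL (the K3⁵ spine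
# composite's N22 input, with no sector geometry and no continued family left to the producer)

Cell `pub-ymgap`, HUMAN RULING D-0062 (Track A), R134 ACCELERATION re-seat `pub-ymgap-dag-n22-c` (strategy s1), generation 7, file J4 (the window-dilated twin of R5ᶜᵖ
`…N22W1RelCentredEdgeAtReadingOfRecord13CoP`).  THEOREMS ONLY; imports J3 `…N22W1RelCentredTermDatum214WindowDilatedKeyedCoP` (§2 guarded binder
`n22_tupleReadingOfRecordCoPOn_windowDilatedTermDatum₀_of_n18Below`) and uses dag-n22-e's CoP rate-reading faces `s_N22_readingOfRecord₁₃CoP[On]_iff`, `s_N18_readingOfRecord₁₃CoP[On]_iff`,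
`readingOfRecord₁₃CoP_bundle_u3` (CoP edition `…RateReadingOfRecord13CoP`; director-ym №160∕№162 v1.5 `CoP`, def-T FILE 23, RR-2 `Node00/Record13DatumKeyCoP`) and RR-2's key faces
`IsDatumOfRecord₁₃CCoP.params ∕ .provisos ∕ .admissible` BY NAME.  `--supports` K3⁵ `SpineGivenEndpointR13SepCoP` (stmt-QuantumFields-20296) as a helper.

WHY.  The K3 spine COMPOSITES at the reading of record (dag-n27-c's XL editions, canonical and regime homes) consume N22 as the rate-record stub `S_N22 (RRec₁₃CoP[On] (readingOfRecord₁₃CoP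
w1 ℓ₃ ne2 ne1))`, i.e. `N22At` at EVERY run length `k`.  R5 ∕ R5ᶜ ∕ R5ᶜᵖ serve it from `S_N18` + R2c's data per level — a continued family `TFc` on a displayed domain family `D`.  THIS
FILE serves the same two stubs with the per-level data IN THE PRODUCER's CURRENCY (J2∕J3): a member family `mF : ℝ → GenTermFun` in the dilation parameter with base-point freeness, the
member `b = 1` = the datum's display, and the (S-last-T′)ʷ ∕ (S-226-T′)ʷ ∕ (P) ∕ (S-vertex-T′)ʷ statements on `ball 1 ρ_b` per base point (dag-n10-c g6 `B13Term214WindowDilated` §4–§7,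
`B13Term214Centred`, `B13Bound226Centred` shapes), apertures `0 < cA < cP < 1`, `cP∕(1−cP) < ρ_b`, numerals at `Mv ↦ (1−cP)⁻²·Mv`.  Mechanism: J3's guarded binder at the constant selector
`ksel := fun _ _ _ _ ↦ k` and the bundle face `readingOfRecord₁₃CoP_bundle_u3` (regime home); the canonical home through the regime `Rg F θ := ∃ D (h : IsDatumOfRecord₁₃CCoP F N D),
h.params = θ` — verbatim the mechanism of R5ᶜᵖ.

WHAT.  §1 ★ `s_N22_readingOfRecord₁₃CoPOn_ofRecordAdm_runTowers_of_s_N18_windowDilatedTermDatum₀` (regime home, any `Rg`) · §2 ★ `s_N22_readingOfRecord₁₃CoP_ofRecordAdm_runTowers_of_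
s_N18_windowDilatedTermDatum₀` (canonical home).  Reading: `w1 := fun F θ ↦ ReadingData.ofRecordAdm F θ.τ9.M N (runTowers fun k ↦ toClusterTower ((𝔇 F θ k).Gn₀)) (sp F θ) (gauge F θ)
(hg F θ) (T₀ F θ) (hT F θ) (li F θ)` (the admissible run towers GENERATED by the (2.14) term data of record).

HONEST FRAMING.  Bookkeeping (two compositions BY NAME); count-neutral; every member statement is a HYPOTHESIS, now AT EVERY LEVEL ((S-vertex-T′) is NOT PRINTED — the first missing
estimate of row n22 s1, asked here in the producer's own currency); `S_N18` is N18's; no inhabitant of `IsDatumOfRecord₁₃CCoP` ∕ admissible tuple claimed (K0⁵ OPEN); nothing of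
Bałaban's asserted; N22 NOT discharged; one finite four-torus programme at fixed ε — NOT infinite volume, NOT OS on ℝ⁴, NOT a mass gap, NOT Clay.  0 `sorry`, 0 `def`, standard axioms.

References (TYPES only): [I] = [Balaban1987RG1] (0.23)–(0.25) pp. 256–257, §1 p. 263, (2.9)–(2.13) pp. 266–268; [II] = [Balaban1988RG2Cluster] (1.41) p. 11, (2.9)–(2.15)
pp. 14–16, (2.26) p. 17, Lemma 3 p. 20, (2.39)–(2.41) p. 21.
-/

noncomputable section

open scoped Matrix.Norms.L2Operator

namespace YMDAG.N22.W1

open Set Metric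
open scoped BigOperators
open Literature.MathematicalPhysics.QuantumFieldTheory.Balaban1983to89
open Literature.MathematicalPhysics.QuantumFieldTheory.Balaban1983to89.T4Continuum
open Literature.MathematicalPhysics.QuantumFieldTheory.Balaban1983to89.T4OutputRate
open Literature.MathematicalPhysics.QuantumFieldTheory.Balaban1983to89.TreeLengthTorus (TPt TDom tsys torusTreeLen torusTreeLen_nonneg)
open Literature.MathematicalPhysics.QuantumFieldTheory.Balaban1983to89.B12TreeDecay (K₀ K₀_pos)
open Literature.MathematicalPhysics.QuantumFieldTheory.Balaban1983to89.B13Lemma3TorusData (TBond)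
open Literature.MathematicalPhysics.QuantumFieldTheory.Balaban1983to89.B13Lemma3TorusTerms (terms weight weight_nonneg)
open Literature.MathematicalPhysics.QuantumFieldTheory.Balaban1983to89.B13Lemma3TorusSocket (Lemma3Numerics)
open Literature.MathematicalPhysics.QuantumFieldTheory.Balaban1983to89.Step (SFConsts)
open Literature.MathematicalPhysics.QuantumFieldTheory.Balaban1983to89.Node00
  (Stage12Params Stage13Params U3Objects₁₁ U3Letters₁₁ NE2Objects₁₁ NE3Letters₁₁ MatA ιSU prependCoupling)
open Literature.MathematicalPhysics.QuantumFieldTheory.Balaban1983to89.Node00.Sect2 (domSys domCount CPair ofBackgroundC spaceI domSites Setting Residual)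
open Literature.MathematicalPhysics.QuantumFieldTheory.Balaban1983to89.Node00.W1
open YMDAG.UVSplit

variable {N : ℕ} [NeZero N]

section Edge


variable (c : (F : T4Family) → Stage13Params F N → ℕ → B13.Consts) (L : (F : T4Family) → Stage13Params F N → ℕ → ℕ) [hL : ∀ F θ k, NeZero (L F θ k)]
  (𝔇 : (F : T4Family) → (θ : Stage13Params F N) → (k : ℕ) → TermData214 (c F θ k) (F.P k) (MatA N) θ.τ9.M (L F θ k))
  (sp : (F : T4Family) → (θ : Stage13Params F N) → (k j : ℕ) → (domSys (F.P k) θ.τ9.M j).Dom → Set (CPair (F.P k) (MatA N)))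
  (gauge : (F : T4Family) → (θ : Stage13Params F N) → (k : ℕ) → GaugeField (F.P k) 0 (Node00.SU N) → GaugeField (F.P k) 0 (Node00.SU N) → ℝ)
  (hg : ∀ (F : T4Family) (θ : Stage13Params F N) (k : ℕ) (U U' : GaugeField (F.P k) 0 (Node00.SU N)), 0 ≤ gauge F θ k U U')
  (T₀ : (F : T4Family) → (θ : Stage13Params F N) → (k : ℕ) → GaugeField (F.P (k + 1)) 0 (Node00.SU N) → GaugeField (F.P k) 0 (Node00.SU N))
  (hT : ∀ (F : T4Family) (θ : Stage13Params F N) (k : ℕ) (U : GaugeField (F.P (k + 1)) 0 (Node00.SU N)),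
    (∀ (j : ℕ) (Y : (domSys (F.P (k + 1)) θ.τ9.M j).Dom), ofBackgroundC (ιSU N) U ∈ sp F θ (k + 1) j Y) →
      ∀ (j : ℕ) (X : (domSys (F.P k) θ.τ9.M j).Dom), ofBackgroundC (ιSU N) (T₀ F θ k U) ∈ sp F θ k j X)
  (li : (F : T4Family) → Stage13Params F N → LetterInputs) (ℓ₃ : T4Family → NE3Letters₁₁)
  (ne2 : (F : T4Family) → Stage13Params F N → (ℕ → ℝ) → List (ULoop F) → ℕ → NE2Objects₁₁)
  (ne1 : (F : T4Family) → Stage13Params F N → (ℕ → ℝ) → List (ULoop F) → NE1pCarriers)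
  (Rg : (F : T4Family) → Stage13Params F N → Prop) {G : Type*} [GaugeGroup G]


open Classical in
/-- **THE EDGE N18 → N22 AT THE REGIME-RESTRICTED READING OF RECORD (CoP), ALL RUN LENGTHS, WINDOW-DILATED MEMBER CURRENCY** (any regime `Rg`): `S_N22 (RRec₁₃CoPOn (readingOfRecord₁₃CoP w1
ℓ₃ ne2 ne1) Rg)` for the (2.14)-generated admissible reading `w1`, from `S_N18` at the same home, the letter signs (`li.μ = 1`, `li.s = ½`) and, per admissible tuple with provisos in
the regime and PER LEVEL `k`, the J3 data for the datum `𝔇 F θ k` (socket letters + numerals, apertures `0 < cA < cP < 1` with `cP∕(1−cP) < ρb`, member family `mF` with base-point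
freeness and `mF s … 1 … = (𝔇 F θ k k′).TF … s …`, the (S-last-T′)ʷ ∕ (S-226-T′)ʷ ∕ (S-vertex-T′)ʷ member statements on `ball 1 ρb` per base point, coupling-blind centre `V` with its
(P)-schema).  Proof: J3 `n22_tupleReadingOfRecordCoPOn_windowDilatedTermDatum₀_of_n18Below` at the constant selector `fun _ _ _ _ ↦ k`, N18 below from `s_N18_readingOfRecord₁₃CoPOn_iff`, bundle face
`readingOfRecord₁₃CoP_bundle_u3`, `s_N22_readingOfRecord₁₃CoPOn_iff`. [cite: Balaban1988RG2Cluster, (1.41) p.11, (2.9)-(2.15) pp.14-16, (2.26) p.17, Lemma 3 p.20 and (2.39)-(2.41) p.21; Balaban1987RG1, (0.23)-(0.25) pp.256-257, §1 p.263, (2.9)-(2.10) pp.266-267 and (2.13) p.268] -/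
theorem s_N22_readingOfRecord₁₃CoPOn_ofRecordAdm_runTowers_of_s_N18_windowDilatedTermDatum₀
    (h18 : S_N18 (RRec₁₃CoPOn (readingOfRecord₁₃CoP (fun F θ => ReadingData.ofRecordAdm F θ.τ9.M N (runTowers fun k => toClusterTower ((𝔇 F θ k).Gn₀)) (sp F θ)
        (gauge F θ) (hg F θ) (T₀ F θ) (hT F θ) (li F θ)) ℓ₃ ne2 ne1) Rg))
    (hnum : ∀ (F : T4Family) (θ : Stage13Params F N), θ.Provisos₁₃Core F N → Rg F θ → θ.Admissible F N →
      0 < (li F θ).C₀ ∧ 0 < (li F θ).θ₅ ∧ (li F θ).θ₅ < 1 ∧ 0 ≤ (li F θ).C₅ ∧ 2 * (li F θ).C₅ / (1 - (li F θ).θ₅) ≤ (li F θ).C₀ ∧ 0 < (li F θ).A ∧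
        (li F θ).μ = 1 ∧ 0 < (li F θ).r ∧ (li F θ).s = (2 : ℝ)⁻¹)
    (hdata : ∀ (F : T4Family) (θ : Stage13Params F N), θ.Provisos₁₃Core F N → Rg F θ → θ.Admissible F N → ∀ (k : ℕ),
      ∃ (_ : NeZero θ.τ9.M) (Sg : Setting (MatA N) G) (Rz : Residual (F.P k) (MatA N))
        (cs : SFConsts) (a a₂ a₂' a₅ a₅' Aabs r₁ E₀ Mv cA cP ρb : ℝ) (mF : ℝ → GenTermFun (F.P k) (MatA N) θ.τ9.M (L F θ k))
        (V : (k' : ℕ) → (domSys (F.P k) θ.τ9.M (k' + 1)).Dom → TermLabel (F.P k) θ.τ9.M k' (L F θ k) →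
          OlderTerms (F.P k) (MatA N) θ.τ9.M k' → CPair (F.P k) (MatA N) → ℂ),
        (∀ (j : ℕ) (Y : (domSys (F.P k) θ.τ9.M j).Dom),
          sp F θ k j Y ⊆ spaceI Sg Rz θ.τ9.M j (domSites (F.P k) θ.τ9.M j Y) cs.α₀ cs.α₁) ∧
        8 ≤ (c F θ k).L ∧ (c F θ k).L = L F θ k ∧ Lemma3Numerics (c F θ k) θ.τ9.M (((c F θ k).L : ℝ) / 2) a a₂ a₂' a₅' Aabs ∧ 0 ≤ (c F θ k).C3act * (c F θ k).ε₁ ∧ 0 ≤ r₁ ∧ (li F θ).κ ≤ r₁ ∧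
        r₁ + 2 * (64 * Real.log 162) + 2 ≤ (1 - 8 * (c F θ k).δ) * (((c F θ k).L : ℝ) / 2) * (c F θ k).κ ∧
        (c F θ k).C3act * (c F θ k).ε₁ * Real.exp (5 * r₁ + 1) * K₀ 64 8 * 9 * 64 ≤ 1 ∧
        Real.exp 1 * 9 * 64 * K₀ 64 8 ^ 2 * ((c F θ k).C3act * (c F θ k).ε₁) ≤ E₀ ∧
        (∀ (k' : ℕ) (Z : (domSys (F.P k) θ.τ9.M (k' + 1)).Dom), 2 * Real.exp (a₅ * ((Z.1).card : ℝ)) ≤ Real.exp (a₅' * ((Z.1).card : ℝ))) ∧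
        0 < cA ∧ cA < cP ∧ cP < 1 ∧ cP / (1 - cP) < ρb ∧ 0 < Mv ∧ (1 - cP)⁻¹ ^ 2 * Mv * ((1 + cA) * θ.γ) ^ 2 ≤ 1 / 2 ∧
        2 * ((1 - cP)⁻¹ ^ 2 * Mv) * E₀ * (1 + cA) ^ 2 ≤ (li F θ).A ∧ (li F θ).r ≤ min cA 1 ∧
        (∀ (k' : ℕ) (Z : (domSys (F.P k) θ.τ9.M (k' + 1)).Dom) (t : TermLabel (F.P k) θ.τ9.M k' (L F θ k)) (old : OlderTerms (F.P k) (MatA N) θ.τ9.M k')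
          (φ : CPair (F.P k) (MatA N)), ∀ s₀ ∈ Ioc (0 : ℝ) θ.γ, ∀ s₁ ∈ Ioc (0 : ℝ) θ.γ, ∀ b : ℂ, mF s₁ k' Z t ((((s₁ / s₀ : ℝ)) : ℂ) * b) old φ = mF s₀ k' Z t b old φ) ∧
        (∀ (k' : ℕ) (Z : (domSys (F.P k) θ.τ9.M (k' + 1)).Dom) (t : TermLabel (F.P k) θ.τ9.M k' (L F θ k)) (s : ℝ), s ∈ Ioc (0 : ℝ) θ.γ →
          ∀ (old : OlderTerms (F.P k) (MatA N) θ.τ9.M k') (φ : CPair (F.P k) (MatA N)), mF s k' Z t 1 old φ = (𝔇 F θ k k').TF Z t (s : ℂ) old φ) ∧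
        (∀ k' : ℕ, k' < k → ∀ old : OlderTerms (F.P k) (MatA N) θ.τ9.M k',
          (∀ (j : Fin (k' + 1)) (Y : (domSys (F.P k) θ.τ9.M j).Dom) (ψ : CPair (F.P k) (MatA N)),
              ψ ∈ spaceI Sg Rz θ.τ9.M j (domSites (F.P k) θ.τ9.M j Y) cs.α₀ cs.α₁ → ‖old j Y ψ‖ ≤ E₀ * Real.exp (-((li F θ).κ * torusTreeLen Y.1))) →
          ∀ (X : (domSys (F.P k) θ.τ9.M (k' + 1)).Dom) (φ : CPair (F.P k) (MatA N)), φ ∈ spaceI Sg Rz θ.τ9.M (k' + 1) (domSites (F.P k) θ.τ9.M (k' + 1) X) cs.α₀ cs.α₁ →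
            ∀ (Z : (domSys (F.P k) θ.τ9.M (k' + 1)).Dom), Z.1 ⊆ X.1 → ∀ t ∈ terms (L F θ k) θ.τ9.M Z, ∀ s₀ ∈ Ioc (0 : ℝ) θ.γ,
              DifferentiableOn ℂ (fun b => mF s₀ k' Z t b old φ) (ball (1 : ℂ) ρb) ∧
                ∀ b ∈ ball (1 : ℂ) ρb, ‖mF s₀ k' Z t b old φ‖ ≤ weight (L F θ k) θ.τ9.M (c F θ k) Z a t * Real.exp (a₅ * ((Z.1).card : ℝ))) ∧
        (∀ k' : ℕ, k' < k → ∀ i : ℕ, i < k' → ∀ (O : Set ℂ), IsOpen O → ∀ s₀ ∈ Ioc (0 : ℝ) θ.γ, ∀ b ∈ ball (1 : ℂ) ρb,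
          ∀ cv : ℂ → OlderTerms (F.P k) (MatA N) θ.τ9.M k',
          (∀ (j : Fin (k' + 1)) (Y : (domSys (F.P k) θ.τ9.M j).Dom) (ψ : CPair (F.P k) (MatA N)),
              ψ ∈ spaceI Sg Rz θ.τ9.M j (domSites (F.P k) θ.τ9.M j Y) cs.α₀ cs.α₁ →
              DifferentiableOn ℂ (fun z => cv z j Y ψ) O ∧ ∀ z ∈ O, ‖cv z j Y ψ‖ ≤ E₀ * Real.exp (-((li F θ).κ * torusTreeLen Y.1))) →
          ∀ (X : (domSys (F.P k) θ.τ9.M (k' + 1)).Dom) (φ : CPair (F.P k) (MatA N)), φ ∈ spaceI Sg Rz θ.τ9.M (k' + 1) (domSites (F.P k) θ.τ9.M (k' + 1) X) cs.α₀ cs.α₁ →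
            ∀ (Z : (domSys (F.P k) θ.τ9.M (k' + 1)).Dom), Z.1 ⊆ X.1 → ∀ t ∈ terms (L F θ k) θ.τ9.M Z,
              DifferentiableOn ℂ (fun z => mF s₀ k' Z t b (cv z) φ) O ∧
                ∀ z ∈ O, ‖mF s₀ k' Z t b (cv z) φ‖ ≤ weight (L F θ k) θ.τ9.M (c F θ k) Z a t * Real.exp (a₅ * ((Z.1).card : ℝ))) ∧
        (∀ k' : ℕ, k' < k → ∀ (O : Set ℂ), IsOpen O → ∀ cv : ℂ → OlderTerms (F.P k) (MatA N) θ.τ9.M k',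
          (∀ (j : Fin (k' + 1)) (Y : (domSys (F.P k) θ.τ9.M j).Dom) (ψ : CPair (F.P k) (MatA N)),
              ψ ∈ spaceI Sg Rz θ.τ9.M j (domSites (F.P k) θ.τ9.M j Y) cs.α₀ cs.α₁ →
              DifferentiableOn ℂ (fun z => cv z j Y ψ) O ∧ ∀ z ∈ O, ‖cv z j Y ψ‖ ≤ E₀ * Real.exp (-((li F θ).κ * torusTreeLen Y.1))) →
          ∀ (X : (domSys (F.P k) θ.τ9.M (k' + 1)).Dom) (φ : CPair (F.P k) (MatA N)), φ ∈ spaceI Sg Rz θ.τ9.M (k' + 1) (domSites (F.P k) θ.τ9.M (k' + 1) X) cs.α₀ cs.α₁ →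
            ∀ (Z : (domSys (F.P k) θ.τ9.M (k' + 1)).Dom), Z.1 ⊆ X.1 → ∀ t ∈ terms (L F θ k) θ.τ9.M Z,
              DifferentiableOn ℂ (fun z => V k' Z t (cv z) φ) O ∧
                ∀ z ∈ O, ‖V k' Z t (cv z) φ‖ ≤ weight (L F θ k) θ.τ9.M (c F θ k) Z a t * Real.exp (a₅ * ((Z.1).card : ℝ))) ∧
        (∀ k' : ℕ, k' < k → ∀ old : OlderTerms (F.P k) (MatA N) θ.τ9.M k',
          (∀ (j : Fin (k' + 1)) (Y : (domSys (F.P k) θ.τ9.M j).Dom) (ψ : CPair (F.P k) (MatA N)),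
              ψ ∈ spaceI Sg Rz θ.τ9.M j (domSites (F.P k) θ.τ9.M j Y) cs.α₀ cs.α₁ → ‖old j Y ψ‖ ≤ E₀ * Real.exp (-((li F θ).κ * torusTreeLen Y.1))) →
          ∀ (X : (domSys (F.P k) θ.τ9.M (k' + 1)).Dom) (φ : CPair (F.P k) (MatA N)), φ ∈ spaceI Sg Rz θ.τ9.M (k' + 1) (domSites (F.P k) θ.τ9.M (k' + 1) X) cs.α₀ cs.α₁ →
            ∀ (Z : (domSys (F.P k) θ.τ9.M (k' + 1)).Dom), Z.1 ⊆ X.1 → ∀ t ∈ terms (L F θ k) θ.τ9.M Z, ∀ s₀ ∈ Ioc (0 : ℝ) θ.γ, ∀ b ∈ ball (1 : ℂ) ρb,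
              ‖mF s₀ k' Z t b old φ - V k' Z t old φ‖ ≤ Mv * s₀ ^ 2 * (weight (L F θ k) θ.τ9.M (c F θ k) Z a t * Real.exp (a₅ * ((Z.1).card : ℝ))))) :
    S_N22 (RRec₁₃CoPOn (readingOfRecord₁₃CoP (fun F θ => ReadingData.ofRecordAdm F θ.τ9.M N (runTowers fun k => toClusterTower ((𝔇 F θ k).Gn₀)) (sp F θ)
        (gauge F θ) (hg F θ) (T₀ F θ) (hT F θ) (li F θ)) ℓ₃ ne2 ne1) Rg) := by
  refine (s_N22_readingOfRecord₁₃CoPOn_iff _ ℓ₃ ne2 ne1 Rg).mpr fun F θ hP hRg hθ k => ?_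
  have h :=
    n22_tupleReadingOfRecordCoPOn_windowDilatedTermDatum₀_of_n18Below c L 𝔇 sp gauge hg T₀ hT li ℓ₃ ne2 ne1 (fun _ _ _ _ => k) Rg (G := G)
      (fun F θ hP hRg hθ _ _ k' hk' => (s_N18_readingOfRecord₁₃CoPOn_iff _ ℓ₃ ne2 ne1 Rg).mp h18 F θ hP hRg hθ k') hnum
      (fun F θ hP hRg hθ _ _ => hdata F θ hP hRg hθ k) F θ hP hRg hθ (fun _ => 0) []
  rwa [readingOfRecord₁₃CoP_bundle_u3] at h

open Classical in
/-- **THE EDGE N18 → N22 AT THE CANONICAL READING OF RECORD (CoP), ALL RUN LENGTHS, WINDOW-DILATED MEMBER CURRENCY**: `S_N22 (RRec₁₃CoP (readingOfRecord₁₃CoP w1 ℓ₃ ne2 ne1))` from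
`S_N18` there + the signs + the J3 data PER admissible tuple with provisos AND LEVEL — the K3⁵ spine composite's N22 input at `S F θ := runTowers fun k ↦ toClusterTower ((𝔇 F θ k).Gn₀)`
in the producer's currency.  Proof: §1 at the
regime `Rg F θ := ∃ D (h : IsDatumOfRecord₁₃CCoP F N D), h.params = θ` (what `S_N18 (RRec₁₃CoP …)` supplies: N18 at KEYED data), then RR-2's `h.params ∕ h.provisos ∕ h.admissible`.
[cite: Balaban1988RG2Cluster, (1.41) p.11, (2.9)-(2.15) pp.14-16, (2.26) p.17, Lemma 3 p.20 and (2.39)-(2.41) p.21; Balaban1987RG1, (0.23)-(0.25) pp.256-257, §1 p.263, (2.9)-(2.10) pp.266-267 and (2.13) p.268] -/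
theorem s_N22_readingOfRecord₁₃CoP_ofRecordAdm_runTowers_of_s_N18_windowDilatedTermDatum₀
    (h18 : S_N18 (RRec₁₃CoP (readingOfRecord₁₃CoP (fun F θ => ReadingData.ofRecordAdm F θ.τ9.M N (runTowers fun k => toClusterTower ((𝔇 F θ k).Gn₀)) (sp F θ)
        (gauge F θ) (hg F θ) (T₀ F θ) (hT F θ) (li F θ)) ℓ₃ ne2 ne1)))
    (hnum : ∀ (F : T4Family) (θ : Stage13Params F N), θ.Provisos₁₃Core F N → θ.Admissible F N →
      0 < (li F θ).C₀ ∧ 0 < (li F θ).θ₅ ∧ (li F θ).θ₅ < 1 ∧ 0 ≤ (li F θ).C₅ ∧ 2 * (li F θ).C₅ / (1 - (li F θ).θ₅) ≤ (li F θ).C₀ ∧ 0 < (li F θ).A ∧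
        (li F θ).μ = 1 ∧ 0 < (li F θ).r ∧ (li F θ).s = (2 : ℝ)⁻¹)
    (hdata : ∀ (F : T4Family) (θ : Stage13Params F N), θ.Provisos₁₃Core F N → θ.Admissible F N → ∀ (k : ℕ),
      ∃ (_ : NeZero θ.τ9.M) (Sg : Setting (MatA N) G) (Rz : Residual (F.P k) (MatA N))
        (cs : SFConsts) (a a₂ a₂' a₅ a₅' Aabs r₁ E₀ Mv cA cP ρb : ℝ) (mF : ℝ → GenTermFun (F.P k) (MatA N) θ.τ9.M (L F θ k))
        (V : (k' : ℕ) → (domSys (F.P k) θ.τ9.M (k' + 1)).Dom → TermLabel (F.P k) θ.τ9.M k' (L F θ k) →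
          OlderTerms (F.P k) (MatA N) θ.τ9.M k' → CPair (F.P k) (MatA N) → ℂ),
        (∀ (j : ℕ) (Y : (domSys (F.P k) θ.τ9.M j).Dom),
          sp F θ k j Y ⊆ spaceI Sg Rz θ.τ9.M j (domSites (F.P k) θ.τ9.M j Y) cs.α₀ cs.α₁) ∧
        8 ≤ (c F θ k).L ∧ (c F θ k).L = L F θ k ∧ Lemma3Numerics (c F θ k) θ.τ9.M (((c F θ k).L : ℝ) / 2) a a₂ a₂' a₅' Aabs ∧ 0 ≤ (c F θ k).C3act * (c F θ k).ε₁ ∧ 0 ≤ r₁ ∧ (li F θ).κ ≤ r₁ ∧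
        r₁ + 2 * (64 * Real.log 162) + 2 ≤ (1 - 8 * (c F θ k).δ) * (((c F θ k).L : ℝ) / 2) * (c F θ k).κ ∧
        (c F θ k).C3act * (c F θ k).ε₁ * Real.exp (5 * r₁ + 1) * K₀ 64 8 * 9 * 64 ≤ 1 ∧
        Real.exp 1 * 9 * 64 * K₀ 64 8 ^ 2 * ((c F θ k).C3act * (c F θ k).ε₁) ≤ E₀ ∧
        (∀ (k' : ℕ) (Z : (domSys (F.P k) θ.τ9.M (k' + 1)).Dom), 2 * Real.exp (a₅ * ((Z.1).card : ℝ)) ≤ Real.exp (a₅' * ((Z.1).card : ℝ))) ∧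
        0 < cA ∧ cA < cP ∧ cP < 1 ∧ cP / (1 - cP) < ρb ∧ 0 < Mv ∧ (1 - cP)⁻¹ ^ 2 * Mv * ((1 + cA) * θ.γ) ^ 2 ≤ 1 / 2 ∧
        2 * ((1 - cP)⁻¹ ^ 2 * Mv) * E₀ * (1 + cA) ^ 2 ≤ (li F θ).A ∧ (li F θ).r ≤ min cA 1 ∧
        (∀ (k' : ℕ) (Z : (domSys (F.P k) θ.τ9.M (k' + 1)).Dom) (t : TermLabel (F.P k) θ.τ9.M k' (L F θ k)) (old : OlderTerms (F.P k) (MatA N) θ.τ9.M k')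
          (φ : CPair (F.P k) (MatA N)), ∀ s₀ ∈ Ioc (0 : ℝ) θ.γ, ∀ s₁ ∈ Ioc (0 : ℝ) θ.γ, ∀ b : ℂ, mF s₁ k' Z t ((((s₁ / s₀ : ℝ)) : ℂ) * b) old φ = mF s₀ k' Z t b old φ) ∧
        (∀ (k' : ℕ) (Z : (domSys (F.P k) θ.τ9.M (k' + 1)).Dom) (t : TermLabel (F.P k) θ.τ9.M k' (L F θ k)) (s : ℝ), s ∈ Ioc (0 : ℝ) θ.γ →
          ∀ (old : OlderTerms (F.P k) (MatA N) θ.τ9.M k') (φ : CPair (F.P k) (MatA N)), mF s k' Z t 1 old φ = (𝔇 F θ k k').TF Z t (s : ℂ) old φ) ∧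
        (∀ k' : ℕ, k' < k → ∀ old : OlderTerms (F.P k) (MatA N) θ.τ9.M k',
          (∀ (j : Fin (k' + 1)) (Y : (domSys (F.P k) θ.τ9.M j).Dom) (ψ : CPair (F.P k) (MatA N)),
              ψ ∈ spaceI Sg Rz θ.τ9.M j (domSites (F.P k) θ.τ9.M j Y) cs.α₀ cs.α₁ → ‖old j Y ψ‖ ≤ E₀ * Real.exp (-((li F θ).κ * torusTreeLen Y.1))) →
          ∀ (X : (domSys (F.P k) θ.τ9.M (k' + 1)).Dom) (φ : CPair (F.P k) (MatA N)), φ ∈ spaceI Sg Rz θ.τ9.M (k' + 1) (domSites (F.P k) θ.τ9.M (k' + 1) X) cs.α₀ cs.α₁ →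
            ∀ (Z : (domSys (F.P k) θ.τ9.M (k' + 1)).Dom), Z.1 ⊆ X.1 → ∀ t ∈ terms (L F θ k) θ.τ9.M Z, ∀ s₀ ∈ Ioc (0 : ℝ) θ.γ,
              DifferentiableOn ℂ (fun b => mF s₀ k' Z t b old φ) (ball (1 : ℂ) ρb) ∧
                ∀ b ∈ ball (1 : ℂ) ρb, ‖mF s₀ k' Z t b old φ‖ ≤ weight (L F θ k) θ.τ9.M (c F θ k) Z a t * Real.exp (a₅ * ((Z.1).card : ℝ))) ∧
        (∀ k' : ℕ, k' < k → ∀ i : ℕ, i < k' → ∀ (O : Set ℂ), IsOpen O → ∀ s₀ ∈ Ioc (0 : ℝ) θ.γ, ∀ b ∈ ball (1 : ℂ) ρb,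
          ∀ cv : ℂ → OlderTerms (F.P k) (MatA N) θ.τ9.M k',
          (∀ (j : Fin (k' + 1)) (Y : (domSys (F.P k) θ.τ9.M j).Dom) (ψ : CPair (F.P k) (MatA N)),
              ψ ∈ spaceI Sg Rz θ.τ9.M j (domSites (F.P k) θ.τ9.M j Y) cs.α₀ cs.α₁ →
              DifferentiableOn ℂ (fun z => cv z j Y ψ) O ∧ ∀ z ∈ O, ‖cv z j Y ψ‖ ≤ E₀ * Real.exp (-((li F θ).κ * torusTreeLen Y.1))) →
          ∀ (X : (domSys (F.P k) θ.τ9.M (k' + 1)).Dom) (φ : CPair (F.P k) (MatA N)), φ ∈ spaceI Sg Rz θ.τ9.M (k' + 1) (domSites (F.P k) θ.τ9.M (k' + 1) X) cs.α₀ cs.α₁ →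
            ∀ (Z : (domSys (F.P k) θ.τ9.M (k' + 1)).Dom), Z.1 ⊆ X.1 → ∀ t ∈ terms (L F θ k) θ.τ9.M Z,
              DifferentiableOn ℂ (fun z => mF s₀ k' Z t b (cv z) φ) O ∧
                ∀ z ∈ O, ‖mF s₀ k' Z t b (cv z) φ‖ ≤ weight (L F θ k) θ.τ9.M (c F θ k) Z a t * Real.exp (a₅ * ((Z.1).card : ℝ))) ∧
        (∀ k' : ℕ, k' < k → ∀ (O : Set ℂ), IsOpen O → ∀ cv : ℂ → OlderTerms (F.P k) (MatA N) θ.τ9.M k',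
          (∀ (j : Fin (k' + 1)) (Y : (domSys (F.P k) θ.τ9.M j).Dom) (ψ : CPair (F.P k) (MatA N)),
              ψ ∈ spaceI Sg Rz θ.τ9.M j (domSites (F.P k) θ.τ9.M j Y) cs.α₀ cs.α₁ →
              DifferentiableOn ℂ (fun z => cv z j Y ψ) O ∧ ∀ z ∈ O, ‖cv z j Y ψ‖ ≤ E₀ * Real.exp (-((li F θ).κ * torusTreeLen Y.1))) →
          ∀ (X : (domSys (F.P k) θ.τ9.M (k' + 1)).Dom) (φ : CPair (F.P k) (MatA N)), φ ∈ spaceI Sg Rz θ.τ9.M (k' + 1) (domSites (F.P k) θ.τ9.M (k' + 1) X) cs.α₀ cs.α₁ →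
            ∀ (Z : (domSys (F.P k) θ.τ9.M (k' + 1)).Dom), Z.1 ⊆ X.1 → ∀ t ∈ terms (L F θ k) θ.τ9.M Z,
              DifferentiableOn ℂ (fun z => V k' Z t (cv z) φ) O ∧
                ∀ z ∈ O, ‖V k' Z t (cv z) φ‖ ≤ weight (L F θ k) θ.τ9.M (c F θ k) Z a t * Real.exp (a₅ * ((Z.1).card : ℝ))) ∧
        (∀ k' : ℕ, k' < k → ∀ old : OlderTerms (F.P k) (MatA N) θ.τ9.M k',
          (∀ (j : Fin (k' + 1)) (Y : (domSys (F.P k) θ.τ9.M j).Dom) (ψ : CPair (F.P k) (MatA N)),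
              ψ ∈ spaceI Sg Rz θ.τ9.M j (domSites (F.P k) θ.τ9.M j Y) cs.α₀ cs.α₁ → ‖old j Y ψ‖ ≤ E₀ * Real.exp (-((li F θ).κ * torusTreeLen Y.1))) →
          ∀ (X : (domSys (F.P k) θ.τ9.M (k' + 1)).Dom) (φ : CPair (F.P k) (MatA N)), φ ∈ spaceI Sg Rz θ.τ9.M (k' + 1) (domSites (F.P k) θ.τ9.M (k' + 1) X) cs.α₀ cs.α₁ →
            ∀ (Z : (domSys (F.P k) θ.τ9.M (k' + 1)).Dom), Z.1 ⊆ X.1 → ∀ t ∈ terms (L F θ k) θ.τ9.M Z, ∀ s₀ ∈ Ioc (0 : ℝ) θ.γ, ∀ b ∈ ball (1 : ℂ) ρb,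
              ‖mF s₀ k' Z t b old φ - V k' Z t old φ‖ ≤ Mv * s₀ ^ 2 * (weight (L F θ k) θ.τ9.M (c F θ k) Z a t * Real.exp (a₅ * ((Z.1).card : ℝ))))) :
    S_N22 (RRec₁₃CoP (readingOfRecord₁₃CoP (fun F θ => ReadingData.ofRecordAdm F θ.τ9.M N (runTowers fun k => toClusterTower ((𝔇 F θ k).Gn₀)) (sp F θ)
        (gauge F θ) (hg F θ) (T₀ F θ) (hT F θ) (li F θ)) ℓ₃ ne2 ne1)) := by
  refine (s_N22_readingOfRecord₁₃CoP_iff _ ℓ₃ ne2 ne1).mpr fun F D h k => ?_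
  have h18' : S_N18 (RRec₁₃CoPOn (readingOfRecord₁₃CoP (fun F θ => ReadingData.ofRecordAdm F θ.τ9.M N (runTowers fun k => toClusterTower ((𝔇 F θ k).Gn₀)) (sp F θ)
        (gauge F θ) (hg F θ) (T₀ F θ) (hT F θ) (li F θ)) ℓ₃ ne2 ne1)
      fun F θ => ∃ (D : Datum F N) (h : Node00.IsDatumOfRecord₁₃CCoP F N D), h.params = θ) := by
    refine (s_N18_readingOfRecord₁₃CoPOn_iff _ ℓ₃ ne2 ne1 _).mpr fun F θ _ hRg _ k' => ?_
    obtain ⟨D', h', rfl⟩ := hRg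
    exact (s_N18_readingOfRecord₁₃CoP_iff _ ℓ₃ ne2 ne1).mp h18 F D' h' k'
  exact (s_N22_readingOfRecord₁₃CoPOn_iff _ ℓ₃ ne2 ne1 _).mp
    (s_N22_readingOfRecord₁₃CoPOn_ofRecordAdm_runTowers_of_s_N18_windowDilatedTermDatum₀ c L 𝔇 sp gauge hg T₀ hT li ℓ₃ ne2 ne1
      (fun F θ => ∃ (D : Datum F N) (h : Node00.IsDatumOfRecord₁₃CCoP F N D), h.params = θ) (G := G) h18' (fun F θ hP _ hθ => hnum F θ hP hθ)
      (fun F θ hP _ hθ => hdata F θ hP hθ))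
    F h.params h.provisos ⟨D, h, rfl⟩ h.admissible k

end Edge

end YMDAG.N22.W1

end
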